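import Summits.QuantumFields.YangMills.Theorems.ColdStartUniversalityLatticeLangevinCentreCovarianceLaw
import Summits.QuantumFields.YangMills.Theorems.ColdStartUniversalityUniformColdStartMixingIntegrand
import Literature.MathematicalPhysics.QuantumFieldTheory.Balaban1983to89.T3CentreSymmetry
import HarnessLib

/-!
# Route `ColdStartUniversality` (LINE 6 «centre-sector reduction», crux K_A1|Γ `NeutralColdStartMixing`
# stmt-QuantumFields-27363): LUMPING OF THE COLD-START DYNAMICS IN THE CRUX'S OWN CURRENCY — loop strings of
# unit-scale averaged loop variables along the SZZ flow, even strings twist-blind, odd strings twist-odd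

Helper file (seat `ym-line-csu-p1`, g14; `--supports stmt-QuantumFields-27363`).  The crux integrand of K_A1 / K_A1|Γ /
K_A2 is `g_os(V) = ∏_{C ∈ os} F.avgObs 𝓔 K C (V read as a level-0 field)` for a loop string `os` of unit-scale labels.
Combining the DYNAMIC centre covariance (`CentreCovariance.markovTransition_twist`, `map_centreMul_eq`: the SZZ dynamics
commutes with every 't Hooft twist `τ_{μ,s}`) with the STATIC sign law of the tree
(`T3CentreSymmetry.exists_ctwist_avgObs`: for every `K, μ` there is a slice `s₀` whose fine twist multiplies every
unit-scale averaged loop variable by `(−1)^{wind_μ}` — Bałaban's (2.17): block averaging maps the fine twist to the unit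
twist):

* `toField_twist_mul` — dictionary: the twisted configuration read as a level-0 field IS `GaugeField.ctwist (−1) μ s`;
* `exists_twist_string_sign` — `g_os(τ_{μ,s₀} * V) = (−1)^{Σ_{C∈os} wind_μ C} g_os(V)`;
* ★ `exists_twist_markovTransition_string` — for every solution family: `P_t g_os (τ_{μ,s₀} * x) = (−1)^{Σ wind_μ} P_t g_os x`;
  hence ★ `markovTransition_string_twist_of_even` (CENTRE-EVEN strings, the sector of K_A1|Γ: `P_t g_os` is
  twist-INVARIANT — the lumped process «started from the class of the 8 twisted classical vacua» cannot tell the vacua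
  apart) and `markovTransition_string_twist_of_odd` (odd strings: `P_t g_os (τ * x) = −P_t g_os x`);
* ★ `integral_string_twistedStart` — for ANY solution `U` from `u` and ANY solution `U'` from the twisted start
  `τ_{μ,s₀} * u` (own probability spaces, own flat drivers): `E g_os(U'_t) = (−1)^{Σ wind_μ} E g_os(U_t)`; in particular
  (`integral_string_coldStart_eq_half_sub`) for an ODD string the cold-start expectation is HALF THE DIFFERENCE between
  the cold start and the twisted classical vacuum: the charged-sector relaxation asked by the aside K_A1 (24809) is
  exactly the MERGING of the dynamics started from the two vacua `1` and `τ`, no Gibbs state involved.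

THEOREMS ONLY, [folklore] / ['t Hooft 1979 §2, McLerran–Svetitsky 1981, Bałaban CMP 109 (2.17)].  RECORD-rung R3
plumbing: no crux, rung or summit statement is proved here and the Yang–Mills mass gap is NOT proved.
-/

set_option autoImplicit false

noncomputable section

namespace Summit.QuantumFields.YangMills.Theorems.ColdStartUniversality.CentreCovariance

open MeasureTheory ProbabilityTheory Filter
open scoped NNReal ENNReal BigOperators
open Literature.Probability.Process Literature.MathematicalPhysics.QuantumFieldTheory
open Literature.MathematicalPhysics.QuantumLattice (fundamentalRep fundamentalLatticeRep)
open Literature.MathematicalPhysics.QuantumFieldTheory.Balaban1983to89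
open Literature.MathematicalPhysics.QuantumFieldTheory.Balaban1983to89.T3ContinuumYM3Torus (negOne₂ negOne₂_comm
  negOne₂_mul_self reTr_negOne₂_mul ULoop3)

variable (F : T3ContinuumYM3Torus.T3Family) (K : ℕ)

/-! ## §1 Dictionary and the static sign law for loop strings -/

/-- **Dictionary**: the twisted configuration `τ_{μ,s} * U`, read as a level-0 field of Bałaban's `K`-th lattice, is the
tree's centre twist `GaugeField.ctwist (−1) μ s` of the field read from `U`. [cite: tHooft1979Flux, §2] -/
theorem toField_twist_mul (μ : Fin 3) (s : ZMod ((F.P K).sitesPerDir 0))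
    (U : GaugeConfig 3 ((F.P K).sitesPerDir 0) (Matrix.specialUnitaryGroup (Fin 2) ℂ)) :
    (fun b : PBond (F.P K) 0 => ((fun e' : Edge 3 ((F.P K).sitesPerDir 0) =>
        if e'.2 = μ ∧ e'.1 μ = s then negOne₂ else (1 : Matrix.specialUnitaryGroup (Fin 2) ℂ)) * U) (b.src, b.dir)) =
      GaugeField.ctwist negOne₂ μ s
        (fun b : PBond (F.P K) 0 => U (b.src, b.dir) : GaugeField (F.P K) 0 (Matrix.specialUnitaryGroup (Fin 2) ℂ)) := by
  funext b
  rw [GaugeField.ctwist_apply, Pi.mul_apply, ite_mul, one_mul]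
  exact if_congr Iff.rfl rfl rfl

/-- Products of signed factors: `∏ (ε_C x_C) = (−1)^{Σ w_C} ∏ x_C`. [folklore] -/
theorem prod_map_negOnePow_mul' (w : ULoop3 F → ℤ) (x : ULoop3 F → ℝ) :
    ∀ Cs : List (ULoop3 F), (Cs.map fun C => (-1 : ℝ) ^ w C * x C).prod = (-1 : ℝ) ^ (Cs.map w).sum * (Cs.map x).prod
  | [] => by simp
  | C :: Cs => by
    rw [List.map_cons, List.prod_cons, prod_map_negOnePow_mul' w x Cs, List.map_cons, List.sum_cons, List.map_cons,
      List.prod_cons, zpow_add₀ (by norm_num : (-1 : ℝ) ≠ 0)]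
    ring

/-- **The sign law for loop strings under a fine twist**: for every `K` and direction `μ` there is a slice `s₀` such that
twisting a configuration by `τ_{μ,s₀}` multiplies the crux integrand `∏_{C∈os} avgObs K C` by `(−1)^{Σ_C wind_μ C}`
(Bałaban (2.17): the fine twist is carried to the unit twist by the `K`-fold block averaging; McLerran–Svetitsky: a
unit line winding `w` times picks up `(−1)^w`). [cite: Balaban1987RG1, (2.17) p.269] -/
theorem exists_twist_string_sign (μ : Fin 3) :
    ∃ s₀ : ZMod ((F.P K).sitesPerDir 0), ∀ (os : List (ULoop3 F))
      (U : GaugeConfig 3 ((F.P K).sitesPerDir 0) (Matrix.specialUnitaryGroup (Fin 2) ℂ)),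
      (os.map fun C => F.avgObs (ExpMeanLog.expMeanLogSU : LoopAverage (Matrix.specialUnitaryGroup (Fin 2) ℂ)) K C
        (fun b : PBond (F.P K) 0 => ((fun e' : Edge 3 ((F.P K).sitesPerDir 0) =>
          if e'.2 = μ ∧ e'.1 μ = s₀ then negOne₂ else (1 : Matrix.specialUnitaryGroup (Fin 2) ℂ)) * U) (b.src, b.dir))).prod =
      (-1 : ℝ) ^ (os.map (ULoop3.wind μ)).sum *
        (os.map fun C => F.avgObs (ExpMeanLog.expMeanLogSU : LoopAverage (Matrix.specialUnitaryGroup (Fin 2) ℂ)) K C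
          (fun b : PBond (F.P K) 0 => U (b.src, b.dir))).prod := by
  obtain ⟨s₀, h₀⟩ := T3ContinuumYM3Torus.exists_ctwist_avgObs F
    (ExpMeanLog.expMeanLogSU : LoopAverage (Matrix.specialUnitaryGroup (Fin 2) ℂ)) negOne₂_comm negOne₂_mul_self
    reTr_negOne₂_mul μ K
  refine ⟨s₀, fun os U => ?_⟩
  rw [toField_twist_mul F K μ s₀ U]
  simp_rw [h₀]
  exact prod_map_negOnePow_mul' F (fun C => C.wind μ) _ os

/-- The crux integrand `V ↦ ∏_{C∈os} avgObs K C (V as a level-0 field)` is measurable and bounded by `1`. [folklore] -/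
theorem measurable_string_and_abs_le_one (os : List (ULoop3 F)) :
    (Measurable fun V : GaugeConfig 3 ((F.P K).sitesPerDir 0) (Matrix.specialUnitaryGroup (Fin 2) ℂ) =>
      (os.map fun C => F.avgObs (ExpMeanLog.expMeanLogSU : LoopAverage (Matrix.specialUnitaryGroup (Fin 2) ℂ)) K C
        (fun b : PBond (F.P K) 0 => V (b.src, b.dir))).prod) ∧
    ∀ V : GaugeConfig 3 ((F.P K).sitesPerDir 0) (Matrix.specialUnitaryGroup (Fin 2) ℂ),
      |(os.map fun C => F.avgObs (ExpMeanLog.expMeanLogSU : LoopAverage (Matrix.specialUnitaryGroup (Fin 2) ℂ)) K C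
        (fun b : PBond (F.P K) 0 => V (b.src, b.dir))).prod| ≤ 1 := by
  have hm : ∀ K' C, Measurable ((F.scheme (ExpMeanLog.expMeanLogSU :
      LoopAverage (Matrix.specialUnitaryGroup (Fin 2) ℂ)) 1).obs K' C) := fun K' C =>
    F.measurable_avgObs (F.avgMeasurable_of_measurableE _ T4ApexTwoLevel.measurableE_expMeanLogSU) K' C
  have hΦ : Measurable fun V : GaugeConfig 3 ((F.P K).sitesPerDir 0) (Matrix.specialUnitaryGroup (Fin 2) ℂ) =>
      (fun b : PBond (F.P K) 0 => V (b.src, b.dir) : GaugeField (F.P K) 0 (Matrix.specialUnitaryGroup (Fin 2) ℂ)) :=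
    measurable_pi_lambda _ fun b => measurable_pi_apply _
  exact ⟨(T4GenFunBounds.measurable_prodObs _ hm K os).comp hΦ, fun V =>
    T4GenFunBounds.abs_prodObs_le_one
      (F.scheme (ExpMeanLog.expMeanLogSU : LoopAverage (Matrix.specialUnitaryGroup (Fin 2) ℂ)) 1)
      (fun K' C U => F.abs_avgObs_le_one _ K' C U) K os _⟩

/-! ## §2 Lumping along the SZZ flow: the Markov semigroup on loop strings -/

section Semigroup

variable (β' : ℝ) {Ω : Type} {mΩ : MeasurableSpace Ω} {P : Measure Ω} [IsProbabilityMeasure P]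
  {W : ℝ≥0 → Ω → (Edge 3 ((F.P K).sitesPerDir 0) × NoiseIdx 2 → ℝ)} (hW : IsFlatBrownian W P)
  {U : GaugeConfig 3 ((F.P K).sitesPerDir 0) (Matrix.specialUnitaryGroup (Fin 2) ℂ) → ℝ≥0 → Ω →
    GaugeConfig 3 ((F.P K).sitesPerDir 0) (Matrix.specialUnitaryGroup (Fin 2) ℂ)}
  (hU : ∀ x, (∀ ω, U x 0 ω = x) ∧
    (latticeLangevinDynamics (fundamentalLatticeRep 2) β').IsSolution (fundamentalRep (Fin 2))
      hW.natFiltration P W (U x))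

include hU in
/-- ★ **LUMPING OF THE SZZ FLOW ON LOOP STRINGS.**  For every step-`K` solution family (all starts, one flat driver,
any SZZ coupling `β'`) and every direction `μ` there is a slice `s₀` such that for every loop string `os`, time `t` and
start `x`: `P_t g_os (τ_{μ,s₀} * x) = (−1)^{Σ_{C∈os} wind_μ C} · P_t g_os x`. [cite: tHooft1979Flux, §2] -/
theorem exists_twist_markovTransition_string (μ : Fin 3) :
    ∃ s₀ : ZMod ((F.P K).sitesPerDir 0), ∀ (os : List (ULoop3 F)) (t : ℝ≥0)
      (x : GaugeConfig 3 ((F.P K).sitesPerDir 0) (Matrix.specialUnitaryGroup (Fin 2) ℂ)),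
      markovTransition U P t
        (fun V => (os.map fun C => F.avgObs (ExpMeanLog.expMeanLogSU : LoopAverage (Matrix.specialUnitaryGroup (Fin 2) ℂ))
          K C (fun b : PBond (F.P K) 0 => V (b.src, b.dir))).prod)
        ((fun e' : Edge 3 ((F.P K).sitesPerDir 0) =>
          if e'.2 = μ ∧ e'.1 μ = s₀ then negOne₂ else (1 : Matrix.specialUnitaryGroup (Fin 2) ℂ)) * x) =
      (-1 : ℝ) ^ (os.map (ULoop3.wind μ)).sum * markovTransition U P t
        (fun V => (os.map fun C => F.avgObs (ExpMeanLog.expMeanLogSU : LoopAverage (Matrix.specialUnitaryGroup (Fin 2) ℂ))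
          K C (fun b : PBond (F.P K) 0 => V (b.src, b.dir))).prod) x := by
  obtain ⟨s₀, h₀⟩ := exists_twist_string_sign F K μ
  refine ⟨s₀, fun os t x => ?_⟩
  obtain ⟨hgm, -⟩ := measurable_string_and_abs_le_one F K os
  rw [markovTransition_twist β' hW hU μ s₀ hgm t x]
  unfold markovTransition
  rw [← integral_const_mul]
  refine integral_congr_ae (ae_of_all _ fun ω => ?_)
  exact h₀ os (U x t ω)

include hU in
/-- ★ **CENTRE-EVEN STRINGS ARE TWIST-BLIND ALONG THE FLOW** (the sector of K_A1|Γ `NeutralColdStartMixing`): if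
`Σ_{C∈os} wind_μ C` is even then `P_t g_os (τ_{μ,s₀} * x) = P_t g_os x` for all `t, x` — on the neutral loop-string
algebra the SZZ semigroup descends to configurations modulo the twist («the lumped quotient process, started from the
class of the twisted classical vacua»). [cite: tHooft1979Flux, §2] -/
theorem markovTransition_string_twist_of_even (μ : Fin 3) :
    ∃ s₀ : ZMod ((F.P K).sitesPerDir 0), ∀ (os : List (ULoop3 F)), Even (os.map (ULoop3.wind μ)).sum →
      ∀ (t : ℝ≥0) (x : GaugeConfig 3 ((F.P K).sitesPerDir 0) (Matrix.specialUnitaryGroup (Fin 2) ℂ)),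
      markovTransition U P t
        (fun V => (os.map fun C => F.avgObs (ExpMeanLog.expMeanLogSU : LoopAverage (Matrix.specialUnitaryGroup (Fin 2) ℂ))
          K C (fun b : PBond (F.P K) 0 => V (b.src, b.dir))).prod)
        ((fun e' : Edge 3 ((F.P K).sitesPerDir 0) =>
          if e'.2 = μ ∧ e'.1 μ = s₀ then negOne₂ else (1 : Matrix.specialUnitaryGroup (Fin 2) ℂ)) * x) =
      markovTransition U P t
        (fun V => (os.map fun C => F.avgObs (ExpMeanLog.expMeanLogSU : LoopAverage (Matrix.specialUnitaryGroup (Fin 2) ℂ))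
          K C (fun b : PBond (F.P K) 0 => V (b.src, b.dir))).prod) x := by
  obtain ⟨s₀, h₀⟩ := exists_twist_markovTransition_string F K β' hW hU μ
  refine ⟨s₀, fun os heven t x => ?_⟩
  rw [h₀ os t x, heven.neg_one_zpow, one_mul]

include hU in
/-- ★ **CENTRE-ODD STRINGS ARE TWIST-ODD ALONG THE FLOW** (the charged sector, e.g. a single unit Polyakov line): if
`Σ_{C∈os} wind_μ C` is odd then `P_t g_os (τ_{μ,s₀} * x) = −P_t g_os x`. [cite: McLerranSvetitsky1981] -/
theorem markovTransition_string_twist_of_odd (μ : Fin 3) :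
    ∃ s₀ : ZMod ((F.P K).sitesPerDir 0), ∀ (os : List (ULoop3 F)), Odd (os.map (ULoop3.wind μ)).sum →
      ∀ (t : ℝ≥0) (x : GaugeConfig 3 ((F.P K).sitesPerDir 0) (Matrix.specialUnitaryGroup (Fin 2) ℂ)),
      markovTransition U P t
        (fun V => (os.map fun C => F.avgObs (ExpMeanLog.expMeanLogSU : LoopAverage (Matrix.specialUnitaryGroup (Fin 2) ℂ))
          K C (fun b : PBond (F.P K) 0 => V (b.src, b.dir))).prod)
        ((fun e' : Edge 3 ((F.P K).sitesPerDir 0) =>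
          if e'.2 = μ ∧ e'.1 μ = s₀ then negOne₂ else (1 : Matrix.specialUnitaryGroup (Fin 2) ℂ)) * x) =
      -markovTransition U P t
        (fun V => (os.map fun C => F.avgObs (ExpMeanLog.expMeanLogSU : LoopAverage (Matrix.specialUnitaryGroup (Fin 2) ℂ))
          K C (fun b : PBond (F.P K) 0 => V (b.src, b.dir))).prod) x := by
  obtain ⟨s₀, h₀⟩ := exists_twist_markovTransition_string F K β' hW hU μ
  refine ⟨s₀, fun os hodd t x => ?_⟩
  rw [h₀ os t x, hodd.neg_one_zpow, neg_one_mul]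

end Semigroup

/-! ## §3 Two starts, two spaces: a solution from `u` against a solution from the twisted start `τ * u` -/

section TwoStarts

variable (β' : ℝ) (μ : Fin 3)

/-- ★ **TWISTED START, ANY TWO SOLUTIONS.**  For every `K, μ` there is a slice `s₀` such that for every start `u`, every
solution `U` from `u` and every solution `U'` from the twisted start `τ_{μ,s₀} * u` (each on its own probability space
with its own flat driver) and every loop string: `E g_os(U'_t) = (−1)^{Σ_{C∈os} wind_μ C} · E g_os(U_t)` for all `t`.
For the cold start `u = 1` the twisted start is one of the twisted classical vacua (torons). [cite: tHooft1979Flux, §2] -/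
theorem integral_string_twistedStart :
    ∃ s₀ : ZMod ((F.P K).sitesPerDir 0), ∀ (os : List (ULoop3 F))
      (u : GaugeConfig 3 ((F.P K).sitesPerDir 0) (Matrix.specialUnitaryGroup (Fin 2) ℂ))
      (Ω : Type) (mΩ : MeasurableSpace Ω) (P : Measure Ω) (_ : IsProbabilityMeasure P)
      (W : ℝ≥0 → Ω → (Edge 3 ((F.P K).sitesPerDir 0) × NoiseIdx 2 → ℝ)) (hW : IsFlatBrownian W P)
      (U : ℝ≥0 → Ω → GaugeConfig 3 ((F.P K).sitesPerDir 0) (Matrix.specialUnitaryGroup (Fin 2) ℂ)),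
      (∀ ω, U 0 ω = u) →
      (latticeLangevinDynamics (fundamentalLatticeRep 2) β').IsSolution (fundamentalRep (Fin 2)) hW.natFiltration P W U →
      ∀ (Ω' : Type) (mΩ' : MeasurableSpace Ω') (P' : Measure Ω') (_ : IsProbabilityMeasure P')
      (W' : ℝ≥0 → Ω' → (Edge 3 ((F.P K).sitesPerDir 0) × NoiseIdx 2 → ℝ)) (hW' : IsFlatBrownian W' P')
      (U' : ℝ≥0 → Ω' → GaugeConfig 3 ((F.P K).sitesPerDir 0) (Matrix.specialUnitaryGroup (Fin 2) ℂ)),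
      (∀ ω, U' 0 ω = (fun e' : Edge 3 ((F.P K).sitesPerDir 0) =>
          if e'.2 = μ ∧ e'.1 μ = s₀ then negOne₂ else (1 : Matrix.specialUnitaryGroup (Fin 2) ℂ)) * u) →
      (latticeLangevinDynamics (fundamentalLatticeRep 2) β').IsSolution (fundamentalRep (Fin 2)) hW'.natFiltration P' W' U' →
      ∀ t : ℝ≥0,
      ∫ ω, (os.map fun C => F.avgObs (ExpMeanLog.expMeanLogSU : LoopAverage (Matrix.specialUnitaryGroup (Fin 2) ℂ))
          K C (fun b : PBond (F.P K) 0 => U' t ω (b.src, b.dir))).prod ∂P' =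
      (-1 : ℝ) ^ (os.map (ULoop3.wind μ)).sum *
        ∫ ω, (os.map fun C => F.avgObs (ExpMeanLog.expMeanLogSU : LoopAverage (Matrix.specialUnitaryGroup (Fin 2) ℂ))
          K C (fun b : PBond (F.P K) 0 => U t ω (b.src, b.dir))).prod ∂P := by
  obtain ⟨s₀, h₀⟩ := exists_twist_string_sign F K μ
  refine ⟨s₀, fun os u Ω mΩ P hP W hW U hU0 hU Ω' mΩ' P' hP' W' hW' U' hU'0 hU' t => ?_⟩
  obtain ⟨hgm, -⟩ := measurable_string_and_abs_le_one F K os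
  set g : GaugeConfig 3 ((F.P K).sitesPerDir 0) (Matrix.specialUnitaryGroup (Fin 2) ℂ) → ℝ := fun V =>
    (os.map fun C => F.avgObs (ExpMeanLog.expMeanLogSU : LoopAverage (Matrix.specialUnitaryGroup (Fin 2) ℂ))
      K C (fun b : PBond (F.P K) 0 => V (b.src, b.dir))).prod with hg
  set c : GaugeConfig 3 ((F.P K).sitesPerDir 0) (Matrix.specialUnitaryGroup (Fin 2) ℂ) :=
    fun e' : Edge 3 ((F.P K).sitesPerDir 0) =>
      if e'.2 = μ ∧ e'.1 μ = s₀ then negOne₂ else (1 : Matrix.specialUnitaryGroup (Fin 2) ℂ) with hc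
  have hlaw := map_centreMul_eq β' c (twist_centre μ s₀) (fun x i j hij => twist_flat μ s₀ x i j hij) u hW hU0 hU
    hW' hU'0 hU' t
  have hmU : Measurable (U t) := (hU.adapted t).mono (hW.natFiltration.le t) le_rfl
  have hmU' : Measurable (U' t) := (hU'.adapted t).mono (hW'.natFiltration.le t) le_rfl
  have hgc : ∀ V, g (c * V) = (-1 : ℝ) ^ (os.map (ULoop3.wind μ)).sum * g V := fun V => h₀ os V
  calc ∫ ω, g (U' t ω) ∂P' = ∫ v, g v ∂(Measure.map (U' t) P') :=
        (integral_map hmU'.aemeasurable hgm.aestronglyMeasurable).symm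
    _ = ∫ v, g v ∂((Measure.map (U t) P).map (fun x => c * x)) := by rw [hlaw]
    _ = ∫ v, g (c * v) ∂(Measure.map (U t) P) :=
        integral_map (measurable_centreMul c).aemeasurable hgm.aestronglyMeasurable
    _ = ∫ ω, g (c * U t ω) ∂P :=
        integral_map hmU.aemeasurable (hgm.comp (measurable_centreMul c)).aestronglyMeasurable
    _ = (-1 : ℝ) ^ (os.map (ULoop3.wind μ)).sum * ∫ ω, g (U t ω) ∂P := by
        simp_rw [hgc]
        exact integral_const_mul _ _

/-- ★ **ODD STRINGS: THE COLD-START (or any) EXPECTATION IS HALF THE DIFFERENCE OF THE TWO STARTS.**  With `s₀` as in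
`integral_string_twistedStart` and `Σ_{C∈os} wind_μ C` odd: `2 · E g_os(U_t) = E g_os(U_t) − E g_os(U'_t)` for every
solution `U` from `u` and `U'` from `τ_{μ,s₀} * u` — the charged-sector relaxation of the aside K_A1
(`UniformColdStartMixing`, whose Gibbs value is `0` by `expectAt_eq_zero_of_odd_SU2`) is the merging in law of the
dynamics started from `u` and from its twist. [cite: McLerranSvetitsky1981] -/
theorem integral_string_eq_half_sub_of_odd :
    ∃ s₀ : ZMod ((F.P K).sitesPerDir 0), ∀ (os : List (ULoop3 F)), Odd (os.map (ULoop3.wind μ)).sum →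
      ∀ (u : GaugeConfig 3 ((F.P K).sitesPerDir 0) (Matrix.specialUnitaryGroup (Fin 2) ℂ))
      (Ω : Type) (mΩ : MeasurableSpace Ω) (P : Measure Ω) (_ : IsProbabilityMeasure P)
      (W : ℝ≥0 → Ω → (Edge 3 ((F.P K).sitesPerDir 0) × NoiseIdx 2 → ℝ)) (hW : IsFlatBrownian W P)
      (U : ℝ≥0 → Ω → GaugeConfig 3 ((F.P K).sitesPerDir 0) (Matrix.specialUnitaryGroup (Fin 2) ℂ)),
      (∀ ω, U 0 ω = u) →
      (latticeLangevinDynamics (fundamentalLatticeRep 2) β').IsSolution (fundamentalRep (Fin 2)) hW.natFiltration P W U →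
      ∀ (Ω' : Type) (mΩ' : MeasurableSpace Ω') (P' : Measure Ω') (_ : IsProbabilityMeasure P')
      (W' : ℝ≥0 → Ω' → (Edge 3 ((F.P K).sitesPerDir 0) × NoiseIdx 2 → ℝ)) (hW' : IsFlatBrownian W' P')
      (U' : ℝ≥0 → Ω' → GaugeConfig 3 ((F.P K).sitesPerDir 0) (Matrix.specialUnitaryGroup (Fin 2) ℂ)),
      (∀ ω, U' 0 ω = (fun e' : Edge 3 ((F.P K).sitesPerDir 0) =>
          if e'.2 = μ ∧ e'.1 μ = s₀ then negOne₂ else (1 : Matrix.specialUnitaryGroup (Fin 2) ℂ)) * u) →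
      (latticeLangevinDynamics (fundamentalLatticeRep 2) β').IsSolution (fundamentalRep (Fin 2)) hW'.natFiltration P' W' U' →
      ∀ t : ℝ≥0,
      2 * ∫ ω, (os.map fun C => F.avgObs (ExpMeanLog.expMeanLogSU : LoopAverage (Matrix.specialUnitaryGroup (Fin 2) ℂ))
          K C (fun b : PBond (F.P K) 0 => U t ω (b.src, b.dir))).prod ∂P =
      (∫ ω, (os.map fun C => F.avgObs (ExpMeanLog.expMeanLogSU : LoopAverage (Matrix.specialUnitaryGroup (Fin 2) ℂ))
          K C (fun b : PBond (F.P K) 0 => U t ω (b.src, b.dir))).prod ∂P) -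
      ∫ ω, (os.map fun C => F.avgObs (ExpMeanLog.expMeanLogSU : LoopAverage (Matrix.specialUnitaryGroup (Fin 2) ℂ))
          K C (fun b : PBond (F.P K) 0 => U' t ω (b.src, b.dir))).prod ∂P' := by
  obtain ⟨s₀, h₀⟩ := integral_string_twistedStart F K β' μ
  refine ⟨s₀, fun os hodd u Ω mΩ P hP W hW U hU0 hU Ω' mΩ' P' hP' W' hW' U' hU'0 hU' t => ?_⟩
  rw [h₀ os u Ω mΩ P hP W hW U hU0 hU Ω' mΩ' P' hP' W' hW' U' hU'0 hU' t, hodd.neg_one_zpow]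
  ring

end TwoStarts

end Summit.QuantumFields.YangMills.Theorems.ColdStartUniversality.CentreCovariance

end
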